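/-
Copyright (c) 2026 the pub-hodgecm-mathlib formalisation cell (harness21).  Prover seat hodgecm-mathlib-LH4-p04 (g5), Track A «(D-RAM) FOUR-FRAME», unit U2H, the census leaf
(ρ2b′-X) `stub_U2H_fixedPointCensus_typeTwo_unit0` — socket (C) (type RamM bottom; dealer WORD #30: lead LH4-p04 + LH4-p06), organ (C-0″) «THE FRAME AT THE UNIFORMISER»:
the whole letter package of the RamM frame at ONE well-chosen uniformiser `ϖM` of `E'_{w₁}` (`α − ρα = ϖM − ρϖM`), at the CM place.  2026-09-04.
-/
import Summits.HodgeConjecture.HodgeConjecture.Theorems.F0P3cDyRamFrameRamMAtPlace              -- ★ p858086 (LH4-p12): (C-0) `ramM_frame_at_place`, the three data, `v_sub_map_lt_one_of_ramM_at_place`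
import Summits.HodgeConjecture.HodgeConjecture.Theorems.F0P3cDyRamFrameRamMDictionary           -- ★ p858161 (F0P3a-p01 (g34)): (C-0b) `ramM_dictionary`
import Summits.HodgeConjecture.HodgeConjecture.Theorems.F0P3cDyRamFrameRamMLetters              -- ★ p858066 (this seat): `exists_twist_of_generator`
import Summits.HodgeConjecture.HodgeConjecture.Theorems.F0P3cDyRamFlipUnitToken                 -- ★ p857943 (F0P3a-p01 (g34)): `hFN_of_dichotomy`
import Summits.HodgeConjecture.HodgeConjecture.Theorems.F0P3cDyRamFourthFieldNonNormUnit        -- ★ p858318 (F0P3a-p01 (g34)): (C-5b) Σ2 `exists_thetaFixed_unit_not_rhoNorm_ramM`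
import Literature.NumberTheory.LocalFields.WildQuadraticDatumUnitNormIndexTwo                  -- ★ `exists_unit_norm_dichotomy_of_isRamifiedQuadraticDatum`
import Literature.NumberTheory.LocalFields.WildQuadraticDatumNonNormUnitLevel                  -- ★ `exists_fixed_unit_not_norm_of_level_pow`
import Literature.NumberTheory.LocalFields.ValuedCompleteIsAdicComplete                         -- ★ `isAdicComplete_valuedInteger_of_completeSpace`
import Literature.NumberTheory.Automorphic.AdicCompletionCompact                                -- ★ `finite_residueField_adicCompletion`
import HarnessLib

/-!
# F0 · P3c · line LH4 «(D-RAM) FOUR-FRAME» — leaf (ρ2b′-X), socket (C) type RamM, organ (C-0″): THE FRAME AT THE UNIFORMISER (Serre 1979 Ch. IV; Rogawski 1990 §4.9)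

Cell `pub/hodgecm-mathlib` (D-0151), crux H413 = `stmt-HodgeConjecture-24833` (helper lane `--supports stmt-HodgeConjecture-24833 --as helper`, count-neutral); THEOREMS ONLY (no
definition, no instance, no notation, no named fact, no `sorry`, default heartbeats).  Socket served: the typed order-count socket (C) `SOCKET-hOCC.v1` 869d0c15 (payer LH4-p14).

On the RamM bottom (`M = E'_{w₁}` totally ramified over `L⁺_v`, the elliptic generator `α` WILD: `|α − ρα| < 1`) the (C) head reads every census letter at ONE uniformiser
`ϖM` of `M` with **`α − ρα = ϖM − ρϖM`** (★ p858066 `exists_twist_of_generator` applied to an auxiliary uniformiser: the census at `(α, h)` IS the census at `(ϖM, h)`,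
twist unit `1`).  **`exists_uniformiser_frame_ramM`** packages, at that `ϖM`, the whole letter list the head consumes: `|ι a| = |a|²`, `#𝓀(M) = #𝓀(L_w)`, the residual
trivialities of `Θ` and `τ = Θρ`, the three ramified quadratic data `(ρ, ϖM, d_ρ)`, `(Θ, ϖM, d_Θ)`, `|ϖM − τϖM| = |ϖM|^{d_τ}` (★ p858086), the `Θ`-unit norm dichotomy
`(c₀, hdich)` (★ `exists_unit_norm_dichotomy_of_isRamifiedQuadraticDatum`) and with it the socket's norm clause `hFN` (★ p857943 `hFN_of_dichotomy`), the anchor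
`n₀ ∉ N_Θ(U_M)` (★ `exists_fixed_unit_not_norm_of_level_pow`), the fixed-fixed law `hF4` (both spellings) and the Klein dictionary `d_Θ = 2g`, `d_τ = 2s0`, `g + s0 = d`,
`2dK = d_ρ + 2g`, `2d′ = d_ρ + d_τ` (★ p858161 `ramM_dictionary`), and the `Θ`-fixed non-`ρ`-norm unit of (C-5b) Σ2 (★ p858318).  Pure composition of ★ organs.
HONEST LABEL: HC_CM is proved only modulo the 7 printed citations (2 remaining named inputs: hLiu418 = stmt-HodgeConjecture-24832, h413 = stmt-HodgeConjecture-24833) until rung 0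
closes; (ρ2b′-X) :418 is an OPEN prover target — this file is a helper (`--supports`), proofs only; nothing printed is asserted.

## References
* [Serre1979] J.-P. Serre, *Local Fields*, GTM 67 (1979): Ch. IV §1–§2 (ramification of a wild quadratic involution), Ch. V §3 (unit norm index two).
* [Rogawski1990] J. D. Rogawski, *Automorphic Representations of Unitary Groups in Three Variables*, Ann. of Math. Stud. 123 (1990), §4.9 pp. 55–58.
-/

set_option autoImplicit false

noncomputable section

open NumberField IsDedekindDomain WithZero IsLocalRing
open Literature.NumberTheory.Automorphic Literature.NumberTheory.Automorphic.UnitaryGroup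
open Literature.NumberTheory.Automorphic.UnitaryThreeFourFrame
open Literature.NumberTheory.LocalFields.WildQuadraticDatum (exists_unit_norm_dichotomy_of_isRamifiedQuadraticDatum exists_fixed_unit_not_norm_of_level_pow)
open scoped Valued

namespace Summit.HodgeConjecture.HodgeConjecture.Cruxes.H413.F0P3cDyRamFrameRamMAtUniformiser

open F0P3cDyRamFrameRamMAtPlace F0P3cDyRamFrameRamMDictionary F0P3cDyRamFrameRamMLetters F0P3cDyRamFlipUnitToken F0P3cDyRamFourthFieldNonNormUnit

/-- **THE RamM FRAME AT THE UNIFORMISER (socket (C)).**  For a RamM frame `(E', c₁, w₁, Θ, α, λ)` over the ramified CM place `w ∣ v` (`ρ = (c₁)_{w₁}`, `τ = Θρ`,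
`|α − ρα| < 1`, `λ² = ι t·λ − ι D` with `X² − tX + D` irreducible over `L_w`, `Θλ·λ = 1`): there are a uniformiser `ϖM` of `E'_{w₁}` with `α − ρα = ϖM − ρϖM`, units
`c₀, n₀` and exponents `d_ρ d_Θ d_τ g s0 dK d′` carrying the complete letter package listed in the module docstring.
[cite: Serre1979, Ch. IV §1–§2; Ch. V §3] [cite: Rogawski1990, §4.9 pp. 55–58] -/
theorem exists_uniformiser_frame_ramM (L : Type) [Field L] [NumberField L] [IsCMField L]
    {v : HeightOneSpectrum (𝓞 ↥(maximalRealSubfield L))} (w : UnitaryGroup.PlacesOver L v) (hw : IsCMField.complexConj L • w.1 = w.1)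
    (E' : Type) [Field E'] [NumberField E'] [Algebra L E'] [Algebra.IsQuadraticExtension L E'] (c₁ : E' ≃ₐ[L] E')
    (w₁ : UnitaryGroup.PlacesOver E' w.1) (hw₁ : c₁ • w₁.1 = w₁.1) (hc₁ : c₁ ≠ 1) (he : v.asIdeal.ramificationIdx' w.1.asIdeal ≠ 1)
    [Fintype (Valued.ResidueField (w.1.adicCompletion L))]
    {ϖ : w.1.adicCompletion L} {d tE : ℕ} (hD : IsRamifiedQuadraticDatum (galAdicCompletionMap (L := L) (IsCMField.complexConj L) hw) ϖ d tE)
    (ρ Θ τ : w₁.1.adicCompletion E' →+* w₁.1.adicCompletion E') (hρ : ρ = galAdicCompletionMap (L := E') c₁ hw₁) (hτ : ∀ x, τ x = Θ (ρ x))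
    {α lam : w₁.1.adicCompletion E'}
    (hρρ : ∀ z, ρ (ρ z) = z) (hvρ : ∀ z, Valued.v (ρ z) = Valued.v z) (hρα : ρ α ≠ α) (hα1 : Valued.v α ≤ 1)
    (hint : ∀ z : w₁.1.adicCompletion E', Valued.v z ≤ 1 → Valued.v ((z - ρ z) / (α - ρ α)) ≤ 1)
    (hjle1 : ∀ a, Valued.v (toPlace w.1 w₁ a) ≤ 1 ↔ Valued.v a ≤ 1) (hjfix : ∀ z : w₁.1.adicCompletion E', ρ z = z ↔ ∃ a, toPlace w.1 w₁ a = z)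
    (hΘj : ∀ a, Θ (toPlace w.1 w₁ a) = toPlace w.1 w₁ ((galAdicCompletionMap (L := L) (IsCMField.complexConj L) hw) a))
    (hΘΘ : ∀ z, Θ (Θ z) = z) (hΘρ : ∀ z, Θ (ρ z) = ρ (Θ z)) (hvΘ : ∀ z, Valued.v (Θ z) = Valued.v z) (hαC : Valued.v (α - ρ α) < 1)
    {t D : w.1.adicCompletion L} (hirr : ∀ x : w.1.adicCompletion L, x * x - t * x + D ≠ 0)
    (hlam2 : lam * lam = toPlace w.1 w₁ t * lam - toPlace w.1 w₁ D) (hΘlam : Θ lam * lam = 1) :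
    ∃ (ϖM c₀ n₀ : w₁.1.adicCompletion E') (dρ dΘ dτ g s0 dK d' : ℕ),
      (∀ a, Valued.v (toPlace w.1 w₁ a) = Valued.v a ^ 2) ∧ Nat.card 𝓀[w₁.1.adicCompletion E'] = Nat.card 𝓀[w.1.adicCompletion L] ∧
      (∀ z : w₁.1.adicCompletion E', Valued.v z ≤ 1 → Valued.v (z - Θ z) < 1) ∧ (∀ z : w₁.1.adicCompletion E', Valued.v z ≤ 1 → Valued.v (z - τ z) < 1) ∧
      Valued.v ϖM = exp (-1 : ℤ) ∧ α - ρ α = ϖM - ρ ϖM ∧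
      IsRamifiedQuadraticDatum ρ ϖM dρ (2 * tE) ∧ IsRamifiedQuadraticDatum Θ ϖM dΘ (2 * tE) ∧ 1 ≤ dτ ∧ Valued.v (ϖM - τ ϖM) = Valued.v ϖM ^ dτ ∧
      Θ c₀ = c₀ ∧ Valued.v c₀ = 1 ∧
      (∀ u : w₁.1.adicCompletion E', Θ u = u → Valued.v u = 1 → (∃ z : w₁.1.adicCompletion E', z * Θ z = u) ∨ ∃ z : w₁.1.adicCompletion E', z * Θ z = c₀ * u) ∧
      (∀ f₀ : w₁.1.adicCompletion E', ρ f₀ = f₀ → Θ f₀ = f₀ → Valued.v f₀ = 1 → ∃ z : w₁.1.adicCompletion E', z * Θ z = f₀) ∧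
      Θ n₀ = n₀ ∧ Valued.v n₀ = 1 ∧ (¬ ∃ z : w₁.1.adicCompletion E', z * Θ z = n₀) ∧
      (∀ f : w₁.1.adicCompletion E', ρ f = f → τ f = f → f ≠ 0 → ∃ n : ℤ, Valued.v f = exp (4 * n)) ∧
      (∀ z : w₁.1.adicCompletion E', ρ z = z → Θ z = z → z ≠ 0 → ∃ n : ℤ, Valued.v z = exp (4 * n)) ∧
      (∃ a : w₁.1.adicCompletion E', Θ a = a ∧ Valued.v a = 1 ∧ ¬ ∃ e : w₁.1.adicCompletion E', ρ e = e ∧ e * Θ e = a * ρ a) ∧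
      dΘ = 2 * g ∧ dτ = 2 * s0 ∧ 1 ≤ g ∧ 1 ≤ s0 ∧ g + s0 = d ∧
      Valued.v (ϖM * τ ϖM - ρ (ϖM * τ ϖM)) = exp (-(2 * (dK : ℤ))) ∧ 2 * dK = dρ + 2 * g ∧
      Valued.v (ϖM * Θ ϖM - ρ (ϖM * Θ ϖM)) = exp (-(2 * (d' : ℤ))) ∧ 2 * d' = dρ + dτ := by
  subst hρ
  haveI : Finite 𝓀[w₁.1.adicCompletion E'] := finite_residueField_adicCompletion E' w₁.1
  -- an auxiliary uniformiser `ϖM₀`, its ρ-datum, and the twist unit `e` (★ p858066): THE uniformiser `ϖM := e·ϖM₀` has `ϖM − ρϖM = α − ρα`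
  obtain ⟨πM, hπM⟩ := w₁.1.valuation_exists_uniformizer E'
  obtain ⟨ϖM₀, hϖM₀⟩ : ∃ ϖM₀ : w₁.1.adicCompletion E', Valued.v ϖM₀ = exp (-1 : ℤ) :=
    ⟨((πM : E') : w₁.1.adicCompletion E'), by rw [IsDedekindDomain.HeightOneSpectrum.valuedAdicCompletion_eq_valuation', hπM]⟩
  haveI : IsAdicComplete 𝓂[w₁.1.adicCompletion E'] 𝒪[w₁.1.adicCompletion E'] :=
    Literature.NumberTheory.LocalFields.isAdicComplete_valuedInteger_of_completeSpace hϖM₀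
  -- (C-0) THE RamM FRAME AT THE PLACE (★ p858086, LH4-p12), first at `ϖM₀`
  obtain ⟨-, hjE2, hqM, -, hΘres, hΘne, -, -⟩ := ramM_frame_at_place L w hw E' c₁ w₁ hw₁ hc₁ he hD Θ hρα hα1 hint hjle1 hjfix hΘj hΘΘ hvΘ hαC hϖM₀
  obtain ⟨dρ₀, hDρ₀⟩ := exists_isRamifiedQuadraticDatum_rho L w hw E' c₁ w₁ hw₁ hρρ hvρ hjfix hjE2 hD hϖM₀
  obtain ⟨e, hρe, hve, hαe⟩ := exists_twist_of_generator hDρ₀ hρα hα1 hint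
  obtain ⟨ϖM, hϖMdef⟩ : ∃ ϖM : w₁.1.adicCompletion E', ϖM = e * ϖM₀ := ⟨_, rfl⟩
  have hϖM : Valued.v ϖM = exp (-1 : ℤ) := by rw [hϖMdef, map_mul, hve, one_mul, hϖM₀]
  have hαϖM : α - galAdicCompletionMap (L := E') c₁ hw₁ α = ϖM - galAdicCompletionMap (L := E') c₁ hw₁ ϖM := by rw [hαe, hϖMdef, map_mul, hρe]; ring
  -- the data at THE uniformiser `ϖM` (★ p858086), the residual triviality of `τ`
  obtain ⟨dΘ, hDΘ⟩ := exists_isRamifiedQuadraticDatum_theta (L := L) (w := w) (hw := hw) (E' := E') (w₁ := w₁) Θ hΘΘ hvΘ hΘres hΘne hjE2 hD hϖM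
  obtain ⟨dρ, hDρ⟩ := exists_isRamifiedQuadraticDatum_rho L w hw E' c₁ w₁ hw₁ hρρ hvρ hjfix hjE2 hD hϖM
  obtain ⟨dτ, hdτ1, hdτ⟩ := exists_tau_depth L w hw E' c₁ w₁ hw₁ hc₁ he hD Θ hρρ hvρ hρα hα1 hint hαC hjfix hΘj hΘΘ hΘρ hvΘ hϖM
  have hτj : ∀ a, τ (toPlace w.1 w₁ a) = toPlace w.1 w₁ ((galAdicCompletionMap (L := L) (IsCMField.complexConj L) hw) a) := fun a => by
    rw [hτ, (hjfix _).2 ⟨a, rfl⟩, hΘj]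
  have hvτ : ∀ z, Valued.v (τ z) = Valued.v z := fun z => by rw [hτ, hvΘ, hvρ]
  have hτres : ∀ z : w₁.1.adicCompletion E', Valued.v z ≤ 1 → Valued.v (z - τ z) < 1 :=
    v_sub_map_lt_one_of_ramM_at_place L w hw E' c₁ w₁ hw₁ hc₁ he τ hρα hα1 hint hαC hτj hvτ
  -- the `Θ`-unit norm dichotomy, the norm clause `hFN` (★ p857943), the anchor `n₀`
  obtain ⟨c₀, hΘc₀, hc₀, hdich⟩ := exists_unit_norm_dichotomy_of_isRamifiedQuadraticDatum Θ ϖM dΘ (2 * tE) hDΘ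
  have hFN := hFN_of_dichotomy L w hw (toPlace w.1 w₁) (galAdicCompletionMap (L := E') c₁ hw₁) Θ hρρ hvρ hjfix hΘj hΘρ hirr hlam2 hΘlam hΘc₀ hc₀ hdich
  obtain ⟨n₀, hΘn₀, hn₀1, -, hn₀N⟩ := exists_fixed_unit_not_norm_of_level_pow Θ ϖM dΘ (2 * tE) hDΘ (n := 0) (by have := hDΘ.2.2.2.2.2.1; omega)
  -- (C-0b) THE DICTIONARY (★ p858161)
  have hdτv : Valued.v (ϖM - τ ϖM) = Valued.v ϖM ^ dτ := by rw [hτ]; exact hdτ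
  obtain ⟨hF4τ, g, s0, dK, d', hg2, hs02, hg1, hs01, hgs, -, hdKv, hdK2, -, hd'v, hd'2⟩ :=
    ramM_dictionary L w hw (toPlace w.1 w₁) (galAdicCompletionMap (L := E') c₁ hw₁) Θ τ hτ hρρ hvρ hΘΘ hΘρ hvΘ hjfix hΘj hjE2 hD hϖM hDρ.2.2.2.2.1
      hDΘ.2.2.2.2.1 hdτv
  have hF4 : ∀ z : w₁.1.adicCompletion E', galAdicCompletionMap (L := E') c₁ hw₁ z = z → Θ z = z → z ≠ 0 → ∃ n : ℤ, Valued.v z = exp (4 * n) :=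
    fun z hz hΘz hz0 => hF4τ z hz (by rw [hτ, hz, hΘz]) hz0
  -- (C-5b) Σ2 the Θ-fixed non-ρ-norm unit (★ p858318); `ρλ ≠ λ` by irreducibility
  have hρlamne : galAdicCompletionMap (L := E') c₁ hw₁ lam ≠ lam := fun h0 => by
    obtain ⟨a, ha⟩ := (hjfix lam).1 h0
    exact hirr a ((map_eq_zero_iff (toPlace w.1 w₁) (RingHom.injective _)).1 (by rw [map_add, map_sub, map_mul, map_mul, ha]; linear_combination hlam2))
  have hf := exists_thetaFixed_unit_not_rhoNorm_ramM L w hw (toPlace w.1 w₁) (galAdicCompletionMap (L := E') c₁ hw₁) Θ τ hτ hρρ hvρ hΘΘ hvΘ hΘρ hjfix hΘj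
    hjle1 hτres hF4τ hϖM hΘlam hρlamne hD
  exact ⟨ϖM, c₀, n₀, dρ, dΘ, dτ, g, s0, dK, d', hjE2, hqM, hΘres, hτres, hϖM, hαϖM, hDρ, hDΘ, hdτ1, hdτv, hΘc₀, hc₀, hdich, hFN, hΘn₀, hn₀1, hn₀N,
    hF4τ, hF4, hf, hg2, hs02, hg1, hs01, hgs, hdKv, hdK2, hd'v, hd'2⟩

end Summit.HodgeConjecture.HodgeConjecture.Cruxes.H413.F0P3cDyRamFrameRamMAtUniformiser

end
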